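import Summits.BirchSwinnertonDyer.BirchSwinnertonDyer.Theorems.GenusKolyvaginAtTwoPowDvdShaCardAtTwoRTMinimaStep
import Summits.BirchSwinnertonDyer.BirchSwinnertonDyer.Theorems.GenusKolyvaginAtTwoPowDvdShaCardAtTwoRTKolyvaginClassOrderGeneral
import Summits.BirchSwinnertonDyer.BirchSwinnertonDyer.Theorems.KolyvaginRoadThreeLevelData
import HarnessLib

/-!
# Route `GenusKolyvaginAtTwo`, crux L_T `PowDvdShaCardAtTwoRT` (stmt-BirchSwinnertonDyer-23242), LINE 18 stub KS `stub_kolyvaginSystemAtTwo`: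
# KOLYVAGIN'S DEPTH MINIMA `M_r` AT 2 — existence, antitonicity, `M_0 = M₀`, attainment, and `M_R = 0` from an all-deep primitive product

LEAD seat `bsd-line-gk2-p1` g17 (cell `bsd-f1-sign2`), `--supports 23242 --as helper`.  THEOREMS ONLY (no definition: the minima are produced
inside the proof by `sSup`); no `sorry`; standard axioms.  BSD is NOT proved by any of this; neither is the crux, nor stub KS, nor stub L.

WHY (memo `Cruxes/PowDvdShaCardAtTwoRT/Lines/plus-descent-lead-g17.md` §5).  The first half of the displayed hypothesis (KS) of gk2-p2's capstone
(`PlusDescent.twinShaLadders_of_kolyvaginSuppliesAtTwo'`): a level `L > M₀` and DEPTH MINIMA `Mr : ℕ → ℕ` — antitone, `Mr 0 = M₀` — such that clause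
(i) of every drop («`2^(L − Mr r)•c_L(e) = 0` for EVERY datum `e` at EVERY square-free `r`-fold product of Zhang–Kolyvagin primes of index `≥ L`»)
holds BY DEFINITION, the minimum is ATTAINED at every depth, and `Mr R = 0` as soon as ONE all-deep `R`-fold product is 2-primitive (the bottom
rung, LEAD engine `false_of_bottomRung_engine_cheb` + gk2-p4's k-minimal loop).  Here `Mr r := L − max{log₂ ord c_L(e)}` (McCallum §5 p. 285);
antitonicity is the step `…RTMinimaStep.exists_datum_mul_pow_zsmul_kolyvaginClass_ne_zero` (signed Q5R + (NPh_L) + Q2 + Gross's CM data); `Mr 0 = M₀`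
is the order formula `addOrderOf_kolyvaginClass_two_eq_pow_sub` at `n = 1` together with the RIGIDITY of conductor-`1` data (all data at `1` over
one frame have the same derived point `P(1) = Tr y(1)`).
* `derivedPoint_eq_of_conductor_one` — two Kolyvagin–Heegner data of conductor `1` over one frame have the same `P(1)`;
* `exists_squarefree_card_primeFactors_kolyvagin` — `r`-fold square-free products of Zhang–Kolyvagin primes of index `≥ L` exist for every `r`;
* **`exists_kolyvaginMinima`** — the minima with: antitone, `Mr 0 = M₀`, `Mr r ≤ L`, clause (i) for all data, attainment, and «primitive all-deep
  `R`-fold product ⟹ `Mr R = 0`».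
Namespace `…Theorems.GenusExact.RelaxedCount`.  Closes nothing.  BSD is NOT proved by any of this.

References: [McCallumLMS1991] §5 p. 285 (the `M_r`), Prop. 5.2, §4 Cor. 4.5; [GrossLMS1991] §4 (4.1), Prop. 5.4, Prop. 6.2; [Kolyvagin1991StructureSha].
-/

set_option autoImplicit false
-- the Theorems namespace of this sub repeats the summit name by design (D-0017 nested layout)
set_option linter.dupNamespace false

noncomputable section

open scoped Classical

open Field NumberField IsDedekindDomain WeierstrassCurve
open Literature.NumberTheory.EllipticCurves
open Literature.NumberTheory.GaloisRepresentations
open Summit.BirchSwinnertonDyer.BirchSwinnertonDyer.Theses.GenusKolyvaginAtTwo (KolyvaginRelationAtTwo)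
open Summit.BirchSwinnertonDyer.Rank1Residual (X11b.KolyvaginAssembly.discr_lt_neg_four)

namespace Summit.BirchSwinnertonDyer.BirchSwinnertonDyer.Theorems.GenusExact.RelaxedCount

variable {K : Type} [Field K] [NumberField K]

/-! ## §1 Rigidity of conductor-`1` data -/

/-- **Two Kolyvagin–Heegner data of conductor `1` over one frame `(Dt, β, ι)` have the same derived point `P(1)`.**  Both `y(1)` map to the
same complex Heegner point (`map_y`) under the injective `E(K[1]) → E(ℂ)`, and both systems of representatives `S` modulo the trivial group
`Gal(K[1]/K[1])` are the whole of `Gal(K[1]/K)`; `P(1) = Σ_{s ∈ S} s·y(1)` (`derivedPoint_one`). [cite: GrossLMS1991, §4 (P_1 = Tr y_1 = y_K)] -/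
theorem derivedPoint_eq_of_conductor_one (W : WeierstrassCurve ℚ) [W.IsElliptic] {N : ℕ} [NeZero N]
    {Dt : ModularForms.ModularParametrizationData W N} {β : ℤ} {ι : K →+* ℂ}
    (d e : KolyvaginHeegnerData Dt β ι 1) : e.derivedPoint = d.derivedPoint := by
  have hy : e.y = d.y :=
    Affine.Point.map_injective (W' := W) (ringClassField K ι 1).subtype.toRatAlgHom (e.map_y.trans d.map_y.symm)
  -- `Gal(K[1]/K[1])` is trivial
  have htriv : ∀ g : ringClassField K ι 1 ≃ₐ[ℚ] ringClassField K ι 1, g ∈ ringClassGalOver ι 1 1 → g = 1 := by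
    intro g hg
    rw [ringClassGalOver, mem_fixingSubgroup_iff] at hg
    ext x
    exact congrArg Subtype.val (hg x (x.2))
  have hS : ∀ (f : KolyvaginHeegnerData Dt β ι 1) (g : ringClassField K ι 1 ≃ₐ[ℚ] ringClassField K ι 1),
      g ∈ f.S ↔ g ∈ ringClassGal ι 1 := by
    intro f g
    refine ⟨fun hg ↦ f.S_subset g hg, fun hg ↦ ?_⟩
    obtain ⟨s, ⟨hsS, hs⟩, -⟩ := f.S_transversal g hg
    have h1 : g⁻¹ * s = 1 := htriv _ hs
    have : s = g := by
      have := congrArg (g * ·) h1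
      simpa using this
    exact this ▸ hsS
  have hSe : e.S = d.S := by
    ext g
    rw [hS e g, hS d g]
  rw [e.derivedPoint_one, d.derivedPoint_one, hSe, hy]

/-! ## §2 Square-free products of Zhang–Kolyvagin primes of every size -/

/-- **`r`-fold square-free products of Zhang–Kolyvagin primes of index `≥ L` exist** (frame of signed Q5R: the EMPTY family already gives infinitely
many such primes; induct on `r`). [cite: McCallumLMS1991, §3 Cor. 3.2] [cite: GrossLMS1991, §3 (3.3)] -/
theorem exists_squarefree_card_primeFactors_kolyvagin (W : WeierstrassCurve ℚ) [W.IsElliptic] [W.IsGloballyMinimal] [NeZero (W.conductorNorm ℤ)]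
    (hcm : ¬ W.HasCM) (hΔ : W.Δ < 0) (hρ : ∀ m : ℕ, W.HasSurjectiveModNGaloisRep (2 ^ m : ℕ))
    (hK : IsImaginaryQuadratic K) (hns : ¬ IsSquare ((NumberField.discr K : ℚ) * -|W.Δ|)) (c : K ≃ₐ[ℚ] K) (hc : c ≠ 1)
    {L : ℕ} (hL : 1 ≤ L) (r : ℕ) :
    ∃ n : ℕ, Squarefree n ∧ n.primeFactors.card = r ∧
      ∀ q ∈ n.primeFactors, Zhang2014.IsKolyvaginPrime (W.conductorNorm ℤ) W K 2 q ∧ L ≤ Zhang2014.kolyvaginIndex W 2 q := by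
  -- infinitely many Zhang–Kolyvagin primes of index `≥ L` (signed Q5R with the empty family)
  have hinf := equivariantChebotarevAtTwo_eigen_of_not_isSquare (W.conductorNorm ℤ) W hcm hΔ K hK hns hρ c hc L hL 0 ![] ![]
    (fun i ↦ i.elim0) (fun i ↦ i.elim0) (fun i ↦ i.elim0) (fun _ _ i ↦ i.elim0)
    (fun a _ ↦ by simp) ![] (fun i ↦ i.elim0) ![] (fun i ↦ i.elim0)
  induction r with
  | zero => exact ⟨1, squarefree_one, by simp, by simp⟩
  | succ r ih =>
    obtain ⟨n, hn, hcard, hnK⟩ := ih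
    have hn0 : n ≠ 0 := hn.ne_zero
    obtain ⟨ℓ, hℓmem, hℓn⟩ := hinf.exists_notMem_finset n.primeFactors
    obtain ⟨-, hKol, hidx, -⟩ := hℓmem
    have hℓp : ℓ.Prime := hKol.1
    have hℓdvd : ¬ ℓ ∣ n := fun h ↦ hℓn (Nat.mem_primeFactors.mpr ⟨hℓp, h, hn0⟩)
    refine ⟨n * ℓ, (Nat.squarefree_mul ((Nat.Prime.coprime_iff_not_dvd hℓp).mpr hℓdvd).symm).mpr ⟨hn, hℓp.squarefree⟩, ?_, ?_⟩
    · rw [Nat.primeFactors_mul hn0 hℓp.ne_zero, hℓp.primeFactors, Finset.card_union_of_disjoint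
        (Finset.disjoint_singleton_right.mpr hℓn), hcard, Finset.card_singleton]
    · intro q hq
      rw [Nat.primeFactors_mul hn0 hℓp.ne_zero, Finset.mem_union] at hq
      rcases hq with hq | hq
      · exact hnK q hq
      · rw [hℓp.primeFactors, Finset.mem_singleton] at hq
        subst hq
        exact ⟨hKol, hidx⟩

/-! ## §3 The minima -/

/-- **KOLYVAGIN'S DEPTH MINIMA AT `2`.**  Frame of L_T (`E/ℚ` globally minimal, non-CM, `Δ < 0`, odd Tamagawa product, `ρ_{E,2^∞}` onto; `K`
imaginary quadratic, `d_K` odd `≠ −3`, Heegner hypothesis, `d_K·(−|Δ|)` not a square; `c ≠ 1`), Q2 granted, (NPh_L) displayed, a conductor-`1`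
datum `d₁` with `2^{M₀} ∣ P(1)`, `2^{M₀+1} ∤ P(1)`, and a level `L ≥ M₀ + 1`.  THEN there are minima `Mr : ℕ → ℕ` with: `Mr (j+1) ≤ Mr j`;
`Mr 0 = M₀`; `Mr r ≤ L`; (i) for every square-free `r`-fold product `n` of Zhang–Kolyvagin primes of index `≥ L` and EVERY datum `e` at `n`,
`2^(L − Mr r)•c_L(e) = 0`; (ii) for every `r` some such `n` and datum `d` with `addOrderOf c_L(d) = 2^(L − Mr r)`; (iii) if some such `R`-fold `n`
carries a datum with `addOrderOf c_L(d) = 2^L` (a 2-PRIMITIVE all-deep product: the bottom rung) then `Mr R = 0`.  (`Mr r = L − max log₂ ord`;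
antitone by `…RTMinimaStep`; `Mr 0 = M₀` by the order formula at `n = 1` and conductor-`1` rigidity.)
[cite: McCallumLMS1991, §5 p. 285, Prop. 5.2, §4 Cor. 4.5] [cite: GrossLMS1991, §4 (4.1), Prop. 6.2] -/
theorem exists_kolyvaginMinima (W : WeierstrassCurve ℚ) [W.IsElliptic] [W.IsGloballyMinimal] [NeZero (W.conductorNorm ℤ)]
    (hQ2 : KolyvaginRelationAtTwo) (hcm : ¬ W.HasCM) (hΔ : W.Δ < 0) (hT : Odd W.tamagawaProduct)
    (hρ : ∀ m : ℕ, W.HasSurjectiveModNGaloisRep (2 ^ m : ℕ))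
    (hK : IsImaginaryQuadratic K) (hodd : Odd (NumberField.discr K)) (h3 : NumberField.discr K ≠ -3)
    (hHe : SatisfiesHeegnerHypothesis (W.conductorNorm ℤ) K) (hns : ¬ IsSquare ((NumberField.discr K : ℚ) * -|W.Δ|))
    (c : K ≃ₐ[ℚ] K) (hc : c ≠ 1)
    (Dt : ModularForms.ModularParametrizationData W (W.conductorNorm ℤ)) (β : ℤ) (ι : K →+* ℂ)
    (d₁ : KolyvaginHeegnerData Dt β ι 1) (M₀ : ℕ)
    (hdiv : ∃ Q : (W.baseChange (ringClassField K ι 1)).toAffine.Point, ((2 ^ M₀ : ℕ) : ℤ) • Q = d₁.derivedPoint)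
    (hndiv : ¬ ∃ Q : (W.baseChange (ringClassField K ι 1)).toAffine.Point, ((2 ^ (M₀ + 1) : ℕ) : ℤ) • Q = d₁.derivedPoint)
    {L : ℕ} (hML : M₀ + 1 ≤ L)
    (hNPh : ∀ z : galH1Torsion (W.baseChange K) ((2 ^ L : ℕ) : ℤ),
      (∀ ρ' ∈ torsionFixing (W.baseChange K) ((2 ^ L : ℕ) : ℤ), h1Eval (W.baseChange K) ((2 ^ L : ℕ) : ℤ) z ρ' = 0) →
      (∀ w : HeightOneSpectrum (𝓞 K), z ∈ selmerLocalKer (W.baseChange K) (w.adicCompletion K) ((2 ^ L : ℕ) : ℤ)) → z = 0) :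
    ∃ Mr : ℕ → ℕ, (∀ j, Mr (j + 1) ≤ Mr j) ∧ Mr 0 = M₀ ∧ (∀ r, Mr r ≤ L) ∧
      (∀ (r n : ℕ), Squarefree n → n.primeFactors.card = r →
        (∀ q ∈ n.primeFactors, Zhang2014.IsKolyvaginPrime (W.conductorNorm ℤ) W K 2 q ∧ L ≤ Zhang2014.kolyvaginIndex W 2 q) →
        ∀ e : KolyvaginHeegnerData Dt β ι n, ((2 ^ (L - Mr r) : ℕ) : ℤ) • e.kolyvaginClass Nat.prime_two L = 0) ∧
      (∀ r : ℕ, ∃ (n : ℕ) (d : KolyvaginHeegnerData Dt β ι n), Squarefree n ∧ n.primeFactors.card = r ∧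
        (∀ q ∈ n.primeFactors, Zhang2014.IsKolyvaginPrime (W.conductorNorm ℤ) W K 2 q ∧ L ≤ Zhang2014.kolyvaginIndex W 2 q) ∧
        addOrderOf (d.kolyvaginClass Nat.prime_two L) = 2 ^ (L - Mr r)) ∧
      (∀ (R n : ℕ), Squarefree n → n.primeFactors.card = R →
        (∀ q ∈ n.primeFactors, Zhang2014.IsKolyvaginPrime (W.conductorNorm ℤ) W K 2 q ∧ L ≤ Zhang2014.kolyvaginIndex W 2 q) →
        ∀ d : KolyvaginHeegnerData Dt β ι n, addOrderOf (d.kolyvaginClass Nat.prime_two L) = 2 ^ L → Mr R = 0) := by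
  have hL : 1 ≤ L := by omega
  have h4 : NumberField.discr K ≠ -4 := fun h ↦ by
    rw [h] at hodd
    exact (Int.not_even_iff_odd.mpr hodd) ⟨-2, by norm_num⟩
  have hD : NumberField.discr K < -4 := X11b.KolyvaginAssembly.discr_lt_neg_four hK ⟨h3, h4⟩
  have hsurj1 : W.HasSurjectiveModNGaloisRep ((2 : ℤ) ^ 1) := by exact_mod_cast hρ 1
  -- admissible products and the height sets
  let Adm : ℕ → ℕ → Prop := fun r n ↦ Squarefree n ∧ n.primeFactors.card = r ∧
    ∀ q ∈ n.primeFactors, Zhang2014.IsKolyvaginPrime (W.conductorNorm ℤ) W K 2 q ∧ L ≤ Zhang2014.kolyvaginIndex W 2 q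
  let H : ℕ → Set ℕ := fun r ↦ {h | ∃ (n : ℕ) (e : KolyvaginHeegnerData Dt β ι n), Adm r n ∧
    addOrderOf (e.kolyvaginClass Nat.prime_two L) = 2 ^ h}
  -- every class has order a power of two `≤ 2^L`
  have hpow : ∀ (n : ℕ) (e : KolyvaginHeegnerData Dt β ι n), ∃ h, h ≤ L ∧ addOrderOf (e.kolyvaginClass Nat.prime_two L) = 2 ^ h := by
    intro n e
    have hdvd : addOrderOf (e.kolyvaginClass Nat.prime_two L) ∣ 2 ^ L := by
      rw [addOrderOf_dvd_iff_nsmul_eq_zero, ← natCast_zsmul]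
      exact zsmul_discreteH1_torsion _ _
    obtain ⟨h, hhL, hh⟩ := (Nat.dvd_prime_pow Nat.prime_two).mp hdvd
    exact ⟨h, hhL, hh⟩
  have hbdd : ∀ r, BddAbove (H r) := fun r ↦ ⟨L, fun h ⟨n, e, _, hh⟩ ↦ by
    obtain ⟨h', hh'L, hh'⟩ := hpow n e
    rw [hh'] at hh
    exact (Nat.pow_right_injective le_rfl hh).symm ▸ hh'L⟩
  -- data exist at every admissible product, and admissible products of every size exist
  have hdata : ∀ n, Squarefree n → (∀ q ∈ n.primeFactors, Zhang2014.IsKolyvaginPrime (W.conductorNorm ℤ) W K 2 q ∧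
      L ≤ Zhang2014.kolyvaginIndex W 2 q) → Nonempty (KolyvaginHeegnerData Dt β ι n) := fun n hn hnK ↦
    BirchSwinnertonDyer.Theorems.nonempty_kolyvaginHeegnerData_of_grossCM
      (phi_heegnerPointOfConductor_mem_range_map_ringClassField_holds (W.conductorNorm ℤ) W K)
      (exists_generator_ringClassGalOver_holds (K := K)) hK hHe Dt β ι d₁.dvd_sq_sub hn (fun q hq ↦ (hnK q hq).1.2.2.2.2.1)
  have hne : ∀ r, (H r).Nonempty := by
    intro r
    obtain ⟨n, hn, hcard, hnK⟩ := exists_squarefree_card_primeFactors_kolyvagin W hcm hΔ hρ hK hns c hc hL r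
    obtain ⟨e⟩ := hdata n hn hnK
    obtain ⟨h, -, hh⟩ := hpow n e
    exact ⟨h, n, e, ⟨hn, hcard, hnK⟩, hh⟩
  -- the maxima `Wr r := sSup (H r)` and the minima `Mr r := L − Wr r`
  let Wr : ℕ → ℕ := fun r ↦ sSup (H r)
  have hWmem : ∀ r, Wr r ∈ H r := fun r ↦ Nat.sSup_mem (hne r) (hbdd r)
  have hWle : ∀ r h, h ∈ H r → h ≤ Wr r := fun r h hh ↦ le_csSup (hbdd r) hh
  have hWL : ∀ r, Wr r ≤ L := fun r ↦ by
    obtain ⟨n, e, -, hh⟩ := hWmem r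
    obtain ⟨h', hh'L, hh'⟩ := hpow n e
    rw [hh'] at hh
    exact (Nat.pow_right_injective le_rfl hh) ▸ hh'L
  -- antitonicity of the minima = monotonicity of the maxima
  have hWmono : ∀ r, Wr r ≤ Wr (r + 1) := by
    intro r
    obtain ⟨n, d, ⟨hn, hcard, hnK⟩, hord⟩ := hWmem r
    rcases Nat.eq_zero_or_pos (Wr r) with h0 | hpos
    · rw [h0]; exact Nat.zero_le _
    obtain ⟨ℓ, d', hℓp, hℓn, -, -, -, hsq, hall, hne0⟩ :=
      exists_datum_mul_pow_zsmul_kolyvaginClass_ne_zero W hQ2 hcm hΔ hT hρ hK hodd h3 hHe hns c hc Dt β ι hL hNPh hn hnK d hpos hord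
    obtain ⟨h', -, hh'⟩ := hpow (n * ℓ) d'
    -- `h' ≥ Wr r`, else `2^(Wr r − 1) • c_L(d′) = 0`
    have hge : Wr r ≤ h' := by
      by_contra hlt
      have hlt' : h' < Wr r := Nat.lt_of_not_le hlt
      apply hne0
      have hdvd : addOrderOf (d'.kolyvaginClass Nat.prime_two L) ∣ 2 ^ (Wr r - 1) := by
        rw [hh']; exact pow_dvd_pow 2 (by omega)
      rw [natCast_zsmul]
      exact addOrderOf_dvd_iff_nsmul_eq_zero.mp hdvd
    have hcard' : (n * ℓ).primeFactors.card = r + 1 := by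
      rw [Nat.primeFactors_mul hn.ne_zero hℓp.ne_zero, hℓp.primeFactors,
        Finset.card_union_of_disjoint (Finset.disjoint_singleton_right.mpr hℓn), hcard, Finset.card_singleton]
    exact hge.trans (hWle (r + 1) h' ⟨n * ℓ, d', ⟨hsq, hcard', hall⟩, hh'⟩)
  -- `Wr 0 = L − M₀`: every conductor-`1` datum has `ord c_L = 2^(L − M₀)`
  have hone : ∀ e : KolyvaginHeegnerData Dt β ι 1, addOrderOf (e.kolyvaginClass Nat.prime_two L) = 2 ^ (L - M₀) := by
    intro e
    let fam : (m : ℕ) → m ∣ 1 → KolyvaginHeegnerData Dt β ι m := fun m hm ↦ (Nat.eq_one_of_dvd_one hm).symm ▸ e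
    have hfam : fam 1 dvd_rfl = e := rfl
    have hPe : e.derivedPoint = d₁.derivedPoint := derivedPoint_eq_of_conductor_one W d₁ e
    have h := PlusDescent.addOrderOf_kolyvaginClass_two_eq_pow_sub (Dt := Dt) (β := β) (ι := ι) hK hodd h3 hHe hsurj1 (n := 1) (M := L)
      squarefree_one (fun q hq ↦ by simp at hq) fam (k := M₀) (by omega)
      (by rw [hfam, hPe]; exact hdiv) (by rw [hfam, hPe]; exact hndiv)
    rwa [hfam] at h
  have hW0 : Wr 0 = L - M₀ := by
    apply le_antisymm
    · obtain ⟨n, e, ⟨hn, hcard, -⟩, hh⟩ := hWmem 0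
      have hn1 : n = 1 := by
        have hpf : n.primeFactors = ∅ := Finset.card_eq_zero.mp hcard
        rcases Nat.primeFactors_eq_empty.mp hpf with h | h
        · exact absurd h hn.ne_zero
        · exact h
      subst hn1
      rw [hone e] at hh
      exact (Nat.pow_right_injective le_rfl hh).symm.le
    · exact hWle 0 _ ⟨1, d₁, ⟨squarefree_one, by simp, by simp⟩, hone d₁⟩
  refine ⟨fun r ↦ L - Wr r, fun j ↦ ?_, ?_, fun r ↦ Nat.sub_le L _, ?_, ?_, ?_⟩
  · -- antitone
    show L - Wr (j + 1) ≤ L - Wr j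
    have := hWmono j
    omega
  · -- `Mr 0 = M₀`
    show L - Wr 0 = M₀
    rw [hW0]; omega
  · -- clause (i): every datum at every admissible `r`-fold product
    intro r n hn hcard hnK e
    obtain ⟨h, -, hh⟩ := hpow n e
    have hle : h ≤ Wr r := hWle r h ⟨n, e, ⟨hn, hcard, hnK⟩, hh⟩
    have hsub : L - (L - Wr r) = Wr r := Nat.sub_sub_self (hWL r)
    have hdvd : addOrderOf (e.kolyvaginClass Nat.prime_two L) ∣ 2 ^ Wr r := by rw [hh]; exact pow_dvd_pow 2 hle
    show ((2 ^ (L - (L - Wr r)) : ℕ) : ℤ) • e.kolyvaginClass Nat.prime_two L = 0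
    rw [hsub, natCast_zsmul]
    exact addOrderOf_dvd_iff_nsmul_eq_zero.mp hdvd
  · -- attainment
    intro r
    obtain ⟨n, d, ⟨hn, hcard, hnK⟩, hh⟩ := hWmem r
    exact ⟨n, d, hn, hcard, hnK, by rw [Nat.sub_sub_self (hWL r)]; exact hh⟩
  · -- a primitive all-deep `R`-fold product forces `Mr R = 0`
    intro R n hn hcard hnK d hord
    have hle : L ≤ Wr R := hWle R L ⟨n, d, ⟨hn, hcard, hnK⟩, hord⟩
    show L - Wr R = 0
    omega

end Summit.BirchSwinnertonDyer.BirchSwinnertonDyer.Theorems.GenusExact.RelaxedCount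

end
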